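import Summits.NavierStokesRegularity.NavierStokesRegularity.Theses.TypeIIInviscidRelaxation
import Summits.NavierStokesRegularity.NavierStokesRegularity.Theorems.Target.Negative.EnergyClassLoadBearing
import Literature.Analysis.FluidPDE.AxisymmetricEuler

/-!
# Crux `OneSidedRadialCriterion` (stmt-NavierStokesRegularity-19059; the registered stub
# `stub_oneSidedRadialCriterion` of the line `radial_inflow_split` of `AxisymSwirlRegular`,
# stmt-NavierStokesRegularity-1964), negative side: the Leray–Hopf (finite-energy) clause is load-bearing

The crux `X₁ = OneSidedRadialCriterion` (route `TypeIIInviscidRelaxation`): a classical solution of the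
unforced Navier–Stokes system on `ℝ³ × [0, T)` which is Leray–Hopf on `[0, T]` from its datum, bounded on
every closed sub-slab, with axisymmetric slices and a rapidly decaying datum, and whose radial momentum
obeys the one-sided gate `x₀u₀ + x₁u₁ = r u_r ≥ -Cν` on an axis tube, extends smoothly past `T`.

This file records, in kernel, which STANDING-CLASS hypothesis of `X₁` any proof must use:

* `exists_axial_drift_witness` — the AXIAL member of the parasitic family of
  Koch–Nadirashvili–Seregin–Šverák (Acta Math. 203 (2009), §1 p. 3; Serrin's `a(t)∇h`): the uniform
  accelerating axial stream `u(t, x) = -log(1 - t) e₂`, `p(t, x) = -(1 - t)⁻¹ x₂` (`ν` arbitrary,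
  `T = 1`), built from the tree's `Target.Negative.uniformVel` / `driftAmp`. It is a classical solution
  on `[0, 1)`, a pressure-free WEAK solution on `[0, 1)` from rest, starts from the ZERO datum (rapidly
  decaying), is bounded on every `[0, T'] × ℝ³` (`T' < 1`), has AXISYMMETRIC slices, has NO radial and
  NO swirl velocity at all (`u₀ = u₁ = 0`, so `r u_r ≡ 0` and EVERY gate `C ≥ 0` holds on EVERY tube),
  even obeys the Type-I rate (`‖u‖ ≤ 2/√(1-t)`), and yet is NOT Leray–Hopf (its slices at `t > 0` are
  non-zero constants, not in `L²(ℝ³)`) and has NO smooth extension past `T = 1` (`‖u(t, 0)‖ → ∞`).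
* `oneSidedRadialCriterion_false_without_lerayHopf` — `X₁` with the clause
  `IsLerayHopfOn T ν 0 (u 0) u` DELETED is FALSE (all other hypotheses kept verbatim, gate included).
* `oneSidedRadialCriterion_false_without_energy` — `X₁` with the Leray–Hopf clause WEAKENED to its
  first field, the pressure-free weak formulation `IsWeakNSSolutionOn T ν 0 (u 0) u`, is still FALSE:
  of the Leray–Hopf bundle exactly the finite-energy clauses are load-bearing.
* `not_isLerayHopfOn_axial_drift` — unconditionally, the witness violates the field `memLp`
  (`u(t) ∈ L²` for `t ∈ [0, T]`) of `IsLerayHopfOn`; `oneSidedRadialCriterion_not_local` — hence the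
  conclusion of `X₁` is not a consequence of any set of hypotheses satisfied by the axial drift: in
  particular not of the gate, axisymmetry, slab bounds, smoothness, the weak formulation and the
  Type-I rate together. Reading for the open half `C ≥ 2` of `X₁`: whatever mechanism continues a
  gated solution must be GLOBAL (it must see `u(t) ∈ L²(ℝ³)` / the energy inequality, i.e. pin the
  Galilean frame, tree barrier `Literature.Barriers.NavierStokesRegularity.GalileanFrameSlot`); no
  argument local to the axis tube — comparison for `Γ = r u_θ`, the gate, the swirl and vorticity
  equations near the axis — can by itself yield `HasSmoothExtensionPast`.

Nothing here closes an item (`--supports`); the crux itself carries the Leray–Hopf clause.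
[cite: KochNadirashviliSereginSverak2009, §1 p. 3 (parasitic solutions)]
-/

noncomputable section

open MeasureTheory Set Function Filter Metric
open scoped Topology RealInnerProductSpace ContDiff InnerProductSpace ENNReal
open Literature.Analysis.FluidPDE
open Summit.NavierStokesRegularity.NavierStokesRegularity.Theorems.Target.Negative

namespace Summit.NavierStokesRegularity.NavierStokesRegularity.Theorems.OneSidedRadialCriterionLoadBearing

-- the problem directory repeats the summit name (`NavierStokesRegularity/NavierStokesRegularity`)
set_option linter.dupNamespace false

/-! ## §1 The axial direction and the axial uniform streams -/

/-- The axial unit vector `e₂ = (0, 0, 1)` has norm one. -/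
theorem norm_single_two : ‖(EuclideanSpace.single (2 : Fin 3) (1 : ℝ) : (EuclideanSpace ℝ (Fin 3)))‖ = 1 := by
  simp

/-- The first (horizontal) component of a multiple of `e₂` vanishes. -/
theorem smul_single_two_apply_zero (c : ℝ) :
    (c • (EuclideanSpace.single (2 : Fin 3) (1 : ℝ) : (EuclideanSpace ℝ (Fin 3)))) 0 = 0 := by
  simp

/-- The second (horizontal) component of a multiple of `e₂` vanishes. -/
theorem smul_single_two_apply_one (c : ℝ) :
    (c • (EuclideanSpace.single (2 : Fin 3) (1 : ℝ) : (EuclideanSpace ℝ (Fin 3)))) 1 = 0 := by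
  simp

/-- The axial component of `c • e₂` is `c`. -/
theorem smul_single_two_apply_two (c : ℝ) :
    (c • (EuclideanSpace.single (2 : Fin 3) (1 : ℝ) : (EuclideanSpace ℝ (Fin 3)))) 2 = c := by
  simp

/-- Rotations about the axis fix the axial vectors `c • e₂`. -/
theorem rotZ_smul_single_two (θ c : ℝ) :
    rotZ θ (c • (EuclideanSpace.single (2 : Fin 3) (1 : ℝ) : (EuclideanSpace ℝ (Fin 3)))) =
      c • (EuclideanSpace.single (2 : Fin 3) (1 : ℝ) : (EuclideanSpace ℝ (Fin 3))) := by
  ext j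
  fin_cases j
  · simp [rotZ_apply_zero]
  · simp [rotZ_apply_one]
  · simp

/-- **Axial uniform streams have axisymmetric slices**: `u(t, ·) ≡ a(t) e₂` is rotation-equivariant
about the axis (both sides equal `a(t) e₂`). -/
theorem isAxisymmetric_uniformVel_axial (a : ℝ → ℝ) (t : ℝ) :
    IsAxisymmetric (uniformVel a (EuclideanSpace.single (2 : Fin 3) (1 : ℝ)) t) := by
  intro θ x
  simp only [uniformVel_apply]
  rw [rotZ_smul_single_two]

/-- **Axial uniform streams carry no radial momentum**: `x₀u₀ + x₁u₁ = r u_r ≡ 0`. -/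
theorem radialMomentum_uniformVel_axial (a : ℝ → ℝ) (t : ℝ) (x : (EuclideanSpace ℝ (Fin 3))) :
    x 0 * uniformVel a (EuclideanSpace.single (2 : Fin 3) (1 : ℝ)) t x 0 +
      x 1 * uniformVel a (EuclideanSpace.single (2 : Fin 3) (1 : ℝ)) t x 1 = 0 := by
  simp only [uniformVel_apply]
  rw [smul_single_two_apply_zero, smul_single_two_apply_one]
  ring

/-- Axial uniform streams satisfy EVERY one-sided radial gate with `C ≥ 0`, on every tube, for every
viscosity `ν ≥ 0`. -/
theorem gate_uniformVel_axial (a : ℝ → ℝ) {C ν : ℝ} (hC : 0 ≤ C) (hν : 0 ≤ ν) (t : ℝ) (x : (EuclideanSpace ℝ (Fin 3))) :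
    -(C * ν) ≤ x 0 * uniformVel a (EuclideanSpace.single (2 : Fin 3) (1 : ℝ)) t x 0 +
      x 1 * uniformVel a (EuclideanSpace.single (2 : Fin 3) (1 : ℝ)) t x 1 := by
  rw [radialMomentum_uniformVel_axial]
  nlinarith

/-- Axial uniform streams are swirl-free and radial-velocity-free: both horizontal components vanish. -/
theorem horizontal_uniformVel_axial (a : ℝ → ℝ) (t : ℝ) (x : (EuclideanSpace ℝ (Fin 3))) :
    uniformVel a (EuclideanSpace.single (2 : Fin 3) (1 : ℝ)) t x 0 = 0 ∧
      uniformVel a (EuclideanSpace.single (2 : Fin 3) (1 : ℝ)) t x 1 = 0 := by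
  simp only [uniformVel_apply]
  exact ⟨smul_single_two_apply_zero _, smul_single_two_apply_one _⟩

/-! ## §2 The axial drift flow `u = -log(1 - t) e₂` on `[0, 1)` -/

/-- `driftAmp t = -log(1 - t)` is nonnegative on `[0, 1)`. -/
theorem driftAmp_nonneg {t : ℝ} (ht : t ∈ Ico (0 : ℝ) 1) : 0 ≤ driftAmp t := by
  have hy : 0 < 1 - t := sub_pos.2 ht.2
  have hle : 1 - t ≤ 1 := by linarith [ht.1]
  have := Real.log_nonpos hy.le hle
  unfold driftAmp
  linarith

/-- `driftAmp` is monotone below `1`: `-log(1 - t) ≤ -log(1 - s)` for `t ≤ s < 1`. -/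
theorem driftAmp_mono {t s : ℝ} (hts : t ≤ s) (hs : s < 1) :
    driftAmp t ≤ driftAmp s := by
  unfold driftAmp
  have h1 : 0 < 1 - s := sub_pos.2 hs
  have h2 : 1 - s ≤ 1 - t := by linarith
  have := Real.log_le_log h1 h2
  linarith

/-- The norm of the axial drift flow is the amplitude: `‖u(t, x)‖ = -log(1 - t)` on `[0, 1)`. -/
theorem norm_axial_drift {t : ℝ} (ht : t ∈ Ico (0 : ℝ) 1) (x : (EuclideanSpace ℝ (Fin 3))) :
    ‖uniformVel driftAmp (EuclideanSpace.single (2 : Fin 3) (1 : ℝ)) t x‖ = driftAmp t := by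
  simp only [uniformVel_apply, norm_smul, Real.norm_eq_abs]
  rw [norm_single_two, mul_one, abs_of_nonneg (driftAmp_nonneg ht)]

/-- The axial drift flow is a classical solution of the unforced system on `[0, 1)`, for every
viscosity (pressure `p = ⟪-a' e₂, x⟫ = -(1 - t)⁻¹ x₂`). -/
theorem isClassical_axial_drift (ν : ℝ) :
    IsClassicalNSSolutionOn (Ico 0 1) ν 0 (uniformVel driftAmp (EuclideanSpace.single (2 : Fin 3) (1 : ℝ)))
      (uniformPres (derivWithin driftAmp (Ico 0 1)) (EuclideanSpace.single (2 : Fin 3) (1 : ℝ))) :=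
  isClassicalNSSolutionOn_uniform (uniqueDiffOn_Ico 0 1) (contDiffOn_driftAmp Ico_subset_Iio_self) ν _

/-- The axial drift flow is a pressure-free weak solution on `[0, 1)` from rest, for every viscosity. -/
theorem isWeak_axial_drift (ν : ℝ) :
    IsWeakNSSolutionOn 1 ν 0 (uniformVel driftAmp (EuclideanSpace.single (2 : Fin 3) (1 : ℝ)) 0)
      (uniformVel driftAmp (EuclideanSpace.single (2 : Fin 3) (1 : ℝ))) :=
  isWeakNSSolutionOn_uniform measurable_driftAmp lintegral_driftAmp_sq_lt_top _ norm_single_two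

/-- The axial drift flow starts from rest: `u(0, ·) = 0`. -/
theorem axial_drift_zero :
    uniformVel driftAmp (EuclideanSpace.single (2 : Fin 3) (1 : ℝ)) 0 = 0 := by
  funext x
  simp [driftAmp_zero]

/-- The datum of the axial drift flow decays rapidly (it is zero). -/
theorem hasRapidSpatialDecay_axial_drift_zero :
    HasRapidSpatialDecay (uniformVel driftAmp (EuclideanSpace.single (2 : Fin 3) (1 : ℝ)) 0) := by
  rw [axial_drift_zero]
  exact hasRapidSpatialDecay_zero

/-- The axial drift flow is bounded on every closed sub-slab `[0, T'] × ℝ³`, `T' < 1`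
(by `-log(1 - T')`). -/
theorem bounded_subslab_axial_drift :
    ∀ T' < (1 : ℝ), ∃ M : ℝ, ∀ t ∈ Icc 0 T', ∀ x : (EuclideanSpace ℝ (Fin 3)),
      ‖uniformVel driftAmp (EuclideanSpace.single (2 : Fin 3) (1 : ℝ)) t x‖ ≤ M := by
  intro T' hT'
  refine ⟨driftAmp T', fun t ht x => ?_⟩
  rw [norm_axial_drift ⟨ht.1, ht.2.trans_lt hT'⟩]
  exact driftAmp_mono ht.2 hT'

/-- The axial drift flow has axisymmetric slices. -/
theorem isAxisymmetric_axial_drift (t : ℝ) :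
    IsAxisymmetric (uniformVel driftAmp (EuclideanSpace.single (2 : Fin 3) (1 : ℝ)) t) :=
  isAxisymmetric_uniformVel_axial driftAmp t

/-- The axial drift flow obeys the Type-I rate at `T = 1` with constant `2`. -/
theorem isTypeIBlowup_axial_drift :
    IsTypeIBlowup (uniformVel driftAmp (EuclideanSpace.single (2 : Fin 3) (1 : ℝ))) 1 := by
  refine ⟨2, ?_⟩
  filter_upwards [Ioo_mem_nhdsLT (show (0 : ℝ) < 1 by norm_num)] with t ht x
  have hy : 0 < 1 - t := sub_pos.2 ht.2
  rw [norm_axial_drift ⟨ht.1.le, ht.2⟩]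
  exact neg_log_le_two_div_sqrt hy

/-- **The axial drift flow has no classical extension past `T = 1`**: an extension would be
continuous at `(1, 0)` from inside `[0, T') × ℝ³`, but `‖u(t, 0)‖ = -log(1 - t) → ∞` as `t ↑ 1`. -/
theorem not_hasSmoothExtensionPast_axial_drift (ν : ℝ) :
    ¬ HasSmoothExtensionPast ν 0 (uniformVel driftAmp (EuclideanSpace.single (2 : Fin 3) (1 : ℝ))) 1 := by
  rintro ⟨T', hT', u', p', hcl, hagree⟩
  have hmem : ((1 : ℝ), (0 : (EuclideanSpace ℝ (Fin 3)))) ∈ Ico 0 T' ×ˢ (univ : Set (EuclideanSpace ℝ (Fin 3))) :=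
    mk_mem_prod ⟨zero_le_one, hT'⟩ (mem_univ _)
  have hcont : ContinuousWithinAt (uncurry u') (Ico 0 T' ×ˢ univ) (1, 0) :=
    hcl.smooth_velocity.continuousOn _ hmem
  have hγ : Tendsto (fun t : ℝ => ((t, (0 : (EuclideanSpace ℝ (Fin 3)))) : ℝ × (EuclideanSpace ℝ (Fin 3)))) (𝓝[<] 1)
      (𝓝[Ico 0 T' ×ˢ univ] ((1 : ℝ), (0 : (EuclideanSpace ℝ (Fin 3))))) := by
    refine tendsto_nhdsWithin_iff.2 ⟨?_, ?_⟩
    · exact ((continuous_id.prodMk continuous_const).tendsto 1).mono_left nhdsWithin_le_nhds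
    · filter_upwards [Ioo_mem_nhdsLT (show (0 : ℝ) < 1 by norm_num)] with t ht
      exact mk_mem_prod ⟨ht.1.le, ht.2.trans hT'⟩ (mem_univ _)
  have hlim : Tendsto (fun t => u' t 0) (𝓝[<] 1) (𝓝 (u' 1 0)) := hcont.tendsto.comp hγ
  have heq : (fun t => driftAmp t • (EuclideanSpace.single (2 : Fin 3) (1 : ℝ) : (EuclideanSpace ℝ (Fin 3)))) =ᶠ[𝓝[<] 1]
      fun t => u' t 0 := by
    filter_upwards [Ioo_mem_nhdsLT (show (0 : ℝ) < 1 by norm_num)] with t ht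
    rw [hagree t ⟨ht.1.le, ht.2⟩]
    rfl
  have hnorm : Tendsto (fun t => ‖driftAmp t • (EuclideanSpace.single (2 : Fin 3) (1 : ℝ) : (EuclideanSpace ℝ (Fin 3)))‖)
      (𝓝[<] 1) (𝓝 ‖u' 1 0‖) :=
    (hlim.congr' heq.symm).norm
  have hnorm' : Tendsto (fun t => ‖driftAmp t • (EuclideanSpace.single (2 : Fin 3) (1 : ℝ) : (EuclideanSpace ℝ (Fin 3)))‖)
      (𝓝[<] 1) atTop := by
    have h : Tendsto (fun t => |driftAmp t|) (𝓝[<] 1) atTop :=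
      tendsto_abs_atTop_atTop.comp tendsto_driftAmp_atTop
    simpa [norm_smul] using h
  exact not_tendsto_atTop_of_tendsto_nhds hnorm hnorm'

/-- **The axial drift flow is not Leray–Hopf on `[0, 1]`** (unconditionally): its slice at
`t = 1/2` is the non-zero constant `log 2 · e₂`, which is not in `L²(ℝ³)` — the field `memLp` of
`IsLerayHopfOn` fails. This is the ONLY standing-class hypothesis of `X₁` the witness violates. -/
theorem not_isLerayHopfOn_axial_drift (ν : ℝ) :
    ¬ IsLerayHopfOn 1 ν 0 (uniformVel driftAmp (EuclideanSpace.single (2 : Fin 3) (1 : ℝ)) 0)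
      (uniformVel driftAmp (EuclideanSpace.single (2 : Fin 3) (1 : ℝ))) := by
  intro hLH
  have hmem : MemLp (uniformVel driftAmp (EuclideanSpace.single (2 : Fin 3) (1 : ℝ)) (1 / 2)) 2
      (volume : Measure (EuclideanSpace ℝ (Fin 3))) :=
    hLH.memLp (1 / 2) ⟨by norm_num, by norm_num⟩
  have hconst : MemLp (fun _ : (EuclideanSpace ℝ (Fin 3)) => driftAmp (1 / 2) • (EuclideanSpace.single (2 : Fin 3) (1 : ℝ) : (EuclideanSpace ℝ (Fin 3))))
      2 (volume : Measure (EuclideanSpace ℝ (Fin 3))) := hmem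
  rw [memLp_const_iff (by norm_num) (by norm_num)] at hconst
  rcases hconst with h0 | hfin
  · -- the constant is non-zero: its axial component is `-log(1/2) = log 2 > 0`
    have h2 := congrArg (fun v : (EuclideanSpace ℝ (Fin 3)) => v 2) h0
    simp only [smul_single_two_apply_two] at h2
    have hpos : 0 < driftAmp (1 / 2) := by
      unfold driftAmp
      have : Real.log (1 - 1 / 2 : ℝ) < 0 := Real.log_neg (by norm_num) (by norm_num)
      linarith
    have h2' : driftAmp (1 / 2) = 0 := by simpa using h2
    exact hpos.ne' h2'
  · -- Lebesgue measure of `(EuclideanSpace ℝ (Fin 3))` is infinite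
    have hvol : (volume : Measure (EuclideanSpace ℝ (Fin 3))) (univ : Set (EuclideanSpace ℝ (Fin 3))) = ⊤ := measure_univ_of_isAddLeftInvariant _
    rw [hvol] at hfin
    exact (lt_irrefl _) hfin

/-- **THE WITNESS, packaged.** For every viscosity `ν` there are `u, p` on `ℝ³ × [0, 1)` with ALL the
standing-class properties of `X₁ = OneSidedRadialCriterion` except Leray–Hopf — classical on `[0, 1)`,
weak (pressure-free) from rest, zero (hence rapidly decaying) datum, bounded on closed sub-slabs,
axisymmetric slices, the radial gate in its strongest form `x₀u₀ + x₁u₁ ≡ 0` (no radial and no swirl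
velocity anywhere), the Type-I rate at `T = 1` — which are NOT Leray–Hopf and have NO smooth extension
past `T = 1`. [cite: KochNadirashviliSereginSverak2009, §1 p. 3 (parasitic solutions)] -/
theorem exists_axial_drift_witness (ν : ℝ) :
    ∃ (u : ℝ → (EuclideanSpace ℝ (Fin 3)) → (EuclideanSpace ℝ (Fin 3))) (p : ℝ → (EuclideanSpace ℝ (Fin 3)) → ℝ),
      IsClassicalNSSolutionOn (Ico 0 1) ν 0 u p ∧
      IsWeakNSSolutionOn 1 ν 0 (u 0) u ∧
      u 0 = 0 ∧ HasRapidSpatialDecay (u 0) ∧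
      (∀ T' < (1 : ℝ), ∃ M : ℝ, ∀ t ∈ Icc 0 T', ∀ x, ‖u t x‖ ≤ M) ∧
      (∀ t ∈ Ico (0 : ℝ) 1, IsAxisymmetric (u t)) ∧
      (∀ t x, x 0 * u t x 0 + x 1 * u t x 1 = 0) ∧
      (∀ t x, u t x 0 = 0 ∧ u t x 1 = 0) ∧
      IsTypeIBlowup u 1 ∧
      ¬ IsLerayHopfOn 1 ν 0 (u 0) u ∧
      ¬ HasSmoothExtensionPast ν 0 u 1 :=
  ⟨uniformVel driftAmp (EuclideanSpace.single (2 : Fin 3) (1 : ℝ)),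
    uniformPres (derivWithin driftAmp (Ico 0 1)) (EuclideanSpace.single (2 : Fin 3) (1 : ℝ)),
    isClassical_axial_drift ν, isWeak_axial_drift ν, axial_drift_zero, hasRapidSpatialDecay_axial_drift_zero,
    bounded_subslab_axial_drift, fun t _ => isAxisymmetric_axial_drift t,
    radialMomentum_uniformVel_axial driftAmp, horizontal_uniformVel_axial driftAmp,
    isTypeIBlowup_axial_drift, not_isLerayHopfOn_axial_drift ν, not_hasSmoothExtensionPast_axial_drift ν⟩

/-! ## §3 The crux with the Leray–Hopf clause deleted / weakened is false -/

/-- **Any proof of `OneSidedRadialCriterion` must use the Leray–Hopf clause**: the statement obtained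
from the crux by DELETING `IsLerayHopfOn T ν 0 (u 0) u` (everything else verbatim: classical on
`[0, T)`, bounded on closed sub-slabs, axisymmetric slices, rapidly decaying datum, one-sided radial
gate on an axis tube) is FALSE — witnessed by the axial drift flow at `ν = 1`, `T = 1`, gate `C = 0`,
`δ = 1`. Classification if it were the crux: refuted-misstated (missing finite-energy normalisation);
the crux itself carries the clause. -/
theorem oneSidedRadialCriterion_false_without_lerayHopf :
    ¬ (∀ (ν T : ℝ), 0 < ν → 0 < T → ∀ (u : ℝ → (EuclideanSpace ℝ (Fin 3)) → (EuclideanSpace ℝ (Fin 3))) (p : ℝ → (EuclideanSpace ℝ (Fin 3)) → ℝ),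
        IsClassicalNSSolutionOn (Set.Ico 0 T) ν 0 u p →
        (∀ T' < T, ∃ M : ℝ, ∀ t ∈ Set.Icc 0 T', ∀ x, ‖u t x‖ ≤ M) →
        (∀ t ∈ Set.Ico 0 T, IsAxisymmetric (u t)) →
        HasRapidSpatialDecay (u 0) →
        (∃ C δ : ℝ, 0 < δ ∧ ∀ t ∈ Set.Ico 0 T, ∀ x, cylRadius x < δ →
          -(C * ν) ≤ x 0 * u t x 0 + x 1 * u t x 1) →
        HasSmoothExtensionPast ν 0 u T) := fun h =>
  not_hasSmoothExtensionPast_axial_drift 1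
    (h 1 1 one_pos one_pos _ _ (isClassical_axial_drift 1) bounded_subslab_axial_drift
      (fun t _ => isAxisymmetric_axial_drift t) hasRapidSpatialDecay_axial_drift_zero
      ⟨0, 1, one_pos, fun t _ x _ => gate_uniformVel_axial driftAmp le_rfl zero_le_one t x⟩)

/-- **Of the Leray–Hopf bundle only the finite-energy clauses are load-bearing**: the statement obtained
from the crux by WEAKENING `IsLerayHopfOn T ν 0 (u 0) u` to its first field, the pressure-free weak
formulation `IsWeakNSSolutionOn T ν 0 (u 0) u` (the clauses `u ∈ L^∞L²`, `u(t) ∈ L²`, the energy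
inequalities, weak `L²`-continuity and strong attainment of the datum deleted), is still FALSE — the
axial drift flow is a weak solution (compactly supported solenoidal tests have zero mean). -/
theorem oneSidedRadialCriterion_false_without_energy :
    ¬ (∀ (ν T : ℝ), 0 < ν → 0 < T → ∀ (u : ℝ → (EuclideanSpace ℝ (Fin 3)) → (EuclideanSpace ℝ (Fin 3))) (p : ℝ → (EuclideanSpace ℝ (Fin 3)) → ℝ),
        IsClassicalNSSolutionOn (Set.Ico 0 T) ν 0 u p →
        IsWeakNSSolutionOn T ν 0 (u 0) u →
        (∀ T' < T, ∃ M : ℝ, ∀ t ∈ Set.Icc 0 T', ∀ x, ‖u t x‖ ≤ M) →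
        (∀ t ∈ Set.Ico 0 T, IsAxisymmetric (u t)) →
        HasRapidSpatialDecay (u 0) →
        (∃ C δ : ℝ, 0 < δ ∧ ∀ t ∈ Set.Ico 0 T, ∀ x, cylRadius x < δ →
          -(C * ν) ≤ x 0 * u t x 0 + x 1 * u t x 1) →
        HasSmoothExtensionPast ν 0 u T) := fun h =>
  not_hasSmoothExtensionPast_axial_drift 1
    (h 1 1 one_pos one_pos _ _ (isClassical_axial_drift 1) (isWeak_axial_drift 1)
      bounded_subslab_axial_drift (fun t _ => isAxisymmetric_axial_drift t)
      hasRapidSpatialDecay_axial_drift_zero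
      ⟨0, 1, one_pos, fun t _ x _ => gate_uniformVel_axial driftAmp le_rfl zero_le_one t x⟩)

/-- **Even with the Type-I rate added** the Leray–Hopf-free statement stays false (the witness obeys
`‖u‖ ≤ 2/√(1-t)`): so neither the gate nor a Type-I rate nor both can replace finite energy in `X₁`;
compare the route's rank-1 twin `Target.Negative.target_false_without_lerayHopf`. -/
theorem oneSidedRadialCriterion_false_without_lerayHopf_typeI :
    ¬ (∀ (ν T : ℝ), 0 < ν → 0 < T → ∀ (u : ℝ → (EuclideanSpace ℝ (Fin 3)) → (EuclideanSpace ℝ (Fin 3))) (p : ℝ → (EuclideanSpace ℝ (Fin 3)) → ℝ),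
        IsClassicalNSSolutionOn (Set.Ico 0 T) ν 0 u p →
        IsWeakNSSolutionOn T ν 0 (u 0) u →
        (∀ T' < T, ∃ M : ℝ, ∀ t ∈ Set.Icc 0 T', ∀ x, ‖u t x‖ ≤ M) →
        (∀ t ∈ Set.Ico 0 T, IsAxisymmetric (u t)) →
        HasRapidSpatialDecay (u 0) →
        IsTypeIBlowup u T →
        (∃ C δ : ℝ, 0 < δ ∧ ∀ t ∈ Set.Ico 0 T, ∀ x, cylRadius x < δ →
          -(C * ν) ≤ x 0 * u t x 0 + x 1 * u t x 1) →
        HasSmoothExtensionPast ν 0 u T) := fun h =>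
  not_hasSmoothExtensionPast_axial_drift 1
    (h 1 1 one_pos one_pos _ _ (isClassical_axial_drift 1) (isWeak_axial_drift 1)
      bounded_subslab_axial_drift (fun t _ => isAxisymmetric_axial_drift t)
      hasRapidSpatialDecay_axial_drift_zero isTypeIBlowup_axial_drift
      ⟨0, 1, one_pos, fun t _ x _ => gate_uniformVel_axial driftAmp le_rfl zero_le_one t x⟩)

/-! ## §4 By name: the crux excludes the witness only through the Leray–Hopf clause -/

/-- **Sanity, by name**: the crux `OneSidedRadialCriterion` implies that the axial drift flow is NOT
Leray–Hopf from rest (which `not_isLerayHopfOn_axial_drift` confirms unconditionally) — the clause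
`IsLerayHopfOn` is exactly where the crux separates itself from the parasitic family. -/
theorem not_isLerayHopfOn_axial_drift_of_oneSidedRadialCriterion
    (h : Summit.NavierStokesRegularity.NavierStokesRegularity.Theses.TypeIIInviscidRelaxation.OneSidedRadialCriterion)
    {ν : ℝ} (hν : 0 < ν) :
    ¬ IsLerayHopfOn 1 ν 0 (uniformVel driftAmp (EuclideanSpace.single (2 : Fin 3) (1 : ℝ)) 0)
      (uniformVel driftAmp (EuclideanSpace.single (2 : Fin 3) (1 : ℝ))) := fun hLH =>
  not_hasSmoothExtensionPast_axial_drift ν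
    (h ν 1 hν one_pos _ _ (isClassical_axial_drift ν) hLH bounded_subslab_axial_drift
      (fun t _ => isAxisymmetric_axial_drift t) hasRapidSpatialDecay_axial_drift_zero
      ⟨0, 1, one_pos, fun t _ x _ => gate_uniformVel_axial driftAmp le_rfl hν.le t x⟩)

/-- **`X₁` is not local to the axis tube.** No conjunction of hypotheses met by the axial drift flow
implies the conclusion of `X₁`: if a predicate `P ν T u p` holds for the axial drift at some viscosity
(with `T = 1`), then `P` does not imply `HasSmoothExtensionPast`. Instances: `P` = «classical ∧ weak ∧
zero datum ∧ slab-bounded ∧ axisymmetric ∧ `r u_r ≡ 0` ∧ swirl-free ∧ Type-I rate», or any statement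
about the solution on an axis tube `{cylRadius < δ} × [0, T)` that the rest state satisfies and that
is invariant under `u ↦ u + a(t) e₂` (the gate, bounds on `Γ = r u_θ`, on `ω`, on `∇u`, …). -/
theorem oneSidedRadialCriterion_not_local
    (P : ℝ → ℝ → (ℝ → (EuclideanSpace ℝ (Fin 3)) → (EuclideanSpace ℝ (Fin 3))) → (ℝ → (EuclideanSpace ℝ (Fin 3)) → ℝ) → Prop) {ν : ℝ}
    (hP : P ν 1 (uniformVel driftAmp (EuclideanSpace.single (2 : Fin 3) (1 : ℝ)))
      (uniformPres (derivWithin driftAmp (Ico 0 1)) (EuclideanSpace.single (2 : Fin 3) (1 : ℝ)))) :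
    ¬ (∀ (ν T : ℝ) (u : ℝ → (EuclideanSpace ℝ (Fin 3)) → (EuclideanSpace ℝ (Fin 3))) (p : ℝ → (EuclideanSpace ℝ (Fin 3)) → ℝ), P ν T u p → HasSmoothExtensionPast ν 0 u T) :=
  fun h => not_hasSmoothExtensionPast_axial_drift ν (h ν 1 _ _ hP)

end Summit.NavierStokesRegularity.NavierStokesRegularity.Theorems.OneSidedRadialCriterionLoadBearing

end
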